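import Literature.Analysis.FluidPDE.TypeIRateOseenMildRepresentative
import Literature.Analysis.FluidPDE.AncientL3BackwardLiouvilleHolds
import Literature.Analysis.FluidPDE.NSBoundedMildSmoothing
import Literature.Analysis.FluidPDE.LocalTypeI
import HarnessLib

/-!
# Crux `RecurrentLiouville` (stmt-NavierStokesRegularity-1589), line `Sketch` (v8 "Lebesgue rungs") —
  stub S1: Albritton–Barker 2019, Thm 1.2 in the class (the backward `L³` rung)

`stub_lebL3BackwardLiouville`: let `(u, p)` be a suitable weak solution of Navier–Stokes (`ν = 1`,
`f = 0`) on the backward slab `ℝ³ × ℝ₋ = (-∞, 0) × ℝ³` with weak gradient `G`, Albritton–Barker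
quantity `𝐈(ℝ³ × ℝ₋) < ∞` and the Type-I rate `‖u(t, x)‖ ≤ C/√(−t)`.  If the slices `u(t)` are
bounded in `L³(ℝ³)` for almost every time `t` of some half-line `(−∞, T₀)`, then `u = 0` almost
everywhere on the slab.

Proof (bookkeeping over two tree-proved facts).
* `exists_oseenMild_repr_of_typeIBound_lt_top` (the slab form of A–B Thm 1.1, forward direction):
  `u` is a.e. equal on the slab to a field `v` continuous on the open slab, with weakly
  divergence-free slices, solving the Oseen integral equation `v(t) = e^{(t−s)Δ}v(s) − B¹ₛ(v,v)(t)`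
  for all `s < t < 0`, and keeping the rate `‖v(t, x)‖ ≤ C/√(−t)`.
* Fubini (`Measure.ae_ae_of_ae_prod`): for a.e. `t < 0`, `u(t) = v(t)` a.e. in space, so
  `‖v(t)‖₃ = ‖u(t)‖₃ ≤ M` for a.e. `t < min T₀ 0`; a null set contains no interval, so there are GOOD
  times `τ_k ∈ (T − k − 2, T − k − 1)`, `τ_k → −∞`, with `‖v(τ_k)‖₃ ≤ M` (`lebL3B_exists_seq`).
* `AlbrittonBarker2019_liouville_L3_backward_holds` (A–B Thm 1.2 for BOUNDED continuous Oseen-mild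
  ancient fields) is applied to the time-shifted field `w(t) = v(t − δ)`, `δ > 0`, which is bounded by
  `C/√δ`, still Oseen-mild (`oseenDuhamel_translate`), and has the good slices `w(τ_k + δ) = v(τ_k)`
  along `τ_k + δ → −∞` (tail with `τ_k < −δ`): `w ≡ 0`, i.e. `v ≡ 0` below `−δ`; `δ ↓ 0` gives
  `v ≡ 0` on the open slab (`lebL3B_liouville_rate`), whence `u = 0` a.e. on the slab.

## References

* D. Albritton, T. Barker, *On local Type I singularities of the Navier–Stokes equations and
  Liouville theorems*, J. Math. Fluid Mech. 21 (2019) no. 43 = arXiv:1811.00502, Thm 1.1 (§3) and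
  Thm 1.2 (§4). [AlbrittonBarker2019]
* G. Koch, N. Nadirashvili, G. Seregin, V. Šverák, Acta Math. 203 (2009) = arXiv:0709.3599, (1.4),
  §4 (i). [KochNadirashviliSereginSverak2009]
-/

noncomputable section

-- the sub-problem namespace repeats the summit name (D-0017 layout `Summit.<S>.<P>.Theorems`)
set_option linter.dupNamespace false

namespace Summit.NavierStokesRegularity.NavierStokesRegularity.Theorems

open MeasureTheory Set Function Filter Topology TopologicalSpace Metric
open Literature.Analysis Literature.Analysis.FluidPDE
open scoped NNReal ENNReal

/-! ## A.e. bookkeeping: slices of the slab, good times along a sequence -/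

/-- **Fubini for a.e. equality on the backward slab.**  If `u = v` a.e. on `(−∞, 0) × ℝ³` (volume
restricted to the slab), then for a.e. `t < 0` the slices agree a.e. in space:
`vol|_{(−∞,0) × ℝ³} = vol|_{(−∞,0)} ⊗ vol` and `Measure.ae_ae_of_ae_prod`. [folklore] -/
theorem lebL3B_ae_slice_ae_eq
    {u v : ℝ → EuclideanSpace ℝ (Fin 3) → EuclideanSpace ℝ (Fin 3)}
    (h : ∀ᵐ w ∂(volume.restrict (Iio (0 : ℝ) ×ˢ (univ : Set (EuclideanSpace ℝ (Fin 3))))),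
      uncurry u w = uncurry v w) :
    ∀ᵐ t ∂((volume : Measure ℝ).restrict (Iio 0)), u t =ᵐ[volume] v t := by
  have h1 : ∀ᵐ w ∂(((volume : Measure ℝ).restrict (Iio 0)).prod
      (volume : Measure (EuclideanSpace ℝ (Fin 3)))), uncurry u w = uncurry v w := by
    rw [Measure.restrict_prod_eq_prod_univ, ← Measure.volume_eq_prod]
    exact h
  filter_upwards [Measure.ae_ae_of_ae_prod h1] with t ht
  filter_upwards [ht] with x hx
  exact hx

/-- **Good times along a sequence tending to `−∞`.**  If a property `P t` holds for a.e. real `t`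
below `T`, then there is a sequence `τ_k → −∞` of times at which `P` holds: the interval
`(T − k − 2, T − k − 1)` has positive length, so it is not contained in the exceptional null set.
[folklore] -/
theorem lebL3B_exists_seq {P : ℝ → Prop} {T : ℝ}
    (h : ∀ᵐ t ∂(volume : Measure ℝ), t < T → P t) :
    ∃ τ : ℕ → ℝ, Tendsto τ atTop atBot ∧ ∀ k, P (τ k) := by
  classical
  have hex : ∀ k : ℕ, ∃ t ∈ Ioo (T - k - 2) (T - k - 1), P t := by
    intro k
    haveI : (ae ((volume : Measure ℝ).restrict (Ioo (T - k - 2) (T - k - 1)))).NeBot := by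
      rw [ae_neBot, ne_eq, Measure.restrict_eq_zero, Real.volume_Ioo, ENNReal.ofReal_eq_zero, not_le]
      linarith
    obtain ⟨t, ht, ht'⟩ :=
      ((ae_restrict_mem measurableSet_Ioo).and (ae_restrict_of_ae (μ := (volume : Measure ℝ))
        (s := Ioo (T - k - 2) (T - k - 1)) h)).exists
    exact ⟨t, ht, ht' (by linarith [ht.2, (Nat.cast_nonneg k : (0 : ℝ) ≤ k)])⟩
  choose τ hτI hτP using hex
  refine ⟨τ, ?_, hτP⟩
  rw [tendsto_atTop_atBot]
  intro b
  refine ⟨⌈T - 1 - b⌉₊, fun k hk => ?_⟩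
  have h1 := (hτI k).2
  have h2 : (⌈T - 1 - b⌉₊ : ℝ) ≤ k := by exact_mod_cast hk
  have h3 : T - 1 - b ≤ ⌈T - 1 - b⌉₊ := Nat.le_ceil _
  linarith

/-! ## Albritton–Barker 2019, Thm 1.2 for Type-I-rate Oseen-mild ancient fields -/

/-- **Albritton–Barker's backward `L³` Liouville theorem in the Type-I-rate Oseen-mild class.**  Let
`v` be continuous on the open slab `(−∞, 0) × ℝ³`, with weakly divergence-free slices, solving the
Oseen integral equation `v(t) = e^{(t−s)Δ}v(s) − B¹ₛ(v, v)(t)` for all `s < t < 0`, with the rate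
`‖v(t, x)‖ ≤ C/√(−t)` (so `v` is bounded on every `(−∞, −δ)`, `δ > 0`, but possibly not near `t = 0`).
If `‖v(τ_k)‖_{L³} ≤ M < ∞` along a sequence `τ_k → −∞`, then `v ≡ 0` on the open slab: the tree-proved
Thm 1.2 (`AlbrittonBarker2019_liouville_L3_backward_holds`, bounded class) applied to every time
shift `w(t) = v(t − δ)`, `δ > 0` — bounded by `C/√δ`, Oseen-mild by `oseenDuhamel_translate`, with
the good slices `w(τ_k + δ) = v(τ_k)` along the tail `τ_k < −δ`.
[cite: AlbrittonBarker2019, Thm 1.2 (arXiv:1811.00502 p. 4; proof §4 p. 9)] -/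
theorem lebL3B_liouville_rate
    {v : ℝ → EuclideanSpace ℝ (Fin 3) → EuclideanSpace ℝ (Fin 3)} {C : ℝ}
    (hcont : ContinuousOn (uncurry v) (Iio 0 ×ˢ univ))
    (hdiv : ∀ t < 0, IsWeaklyDivFree (v t))
    (hmild : ∀ s t : ℝ, s < t → t < 0 → ∀ x,
      v t x = UnboundedOperators.heatExtension (v s) (t - s) x - oseenDuhamel 1 s v v t x)
    (hdec : HasTypeITimeDecay C v)
    {τ : ℕ → ℝ} {M : ℝ≥0∞} (hM : M < ⊤) (hτ : Tendsto τ atTop atBot)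
    (hτM : ∀ k, eLpNorm (v (τ k)) 3 volume ≤ M) :
    ∀ t < 0, ∀ x, v t x = 0 := by
  -- `0 ≤ C`, from the rate at `(t, x) = (-1, 0)`
  have hC0 : 0 ≤ C := by
    have h := hdec (-1) (by norm_num) 0
    rw [neg_neg, Real.sqrt_one, div_one] at h
    exact (norm_nonneg _).trans h
  -- every time shift `w(t) = v(t - δ)`, `δ > 0`, vanishes on the open slab
  have key : ∀ δ : ℝ, 0 < δ → ∀ t < 0, ∀ x, v (t + -δ) x = 0 := by
    intro δ hδ
    -- the tail of the sequence below `-δ`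
    obtain ⟨k₀, hk₀⟩ := (hτ.eventually_lt_atBot (-δ)).exists_forall_of_atTop
    -- the hypotheses of A–B Thm 1.2 for the shifted field
    have hwc : ContinuousOn (uncurry fun r => v (r + -δ)) (Iio 0 ×ˢ univ) := by
      have h1 : ContinuousOn (uncurry v ∘ fun z : ℝ × EuclideanSpace ℝ (Fin 3) => (z.1 + -δ, z.2))
          (Iio 0 ×ˢ univ) := by
        refine hcont.comp (by fun_prop) fun z hz => ⟨?_, mem_univ _⟩
        have hz1 : z.1 < 0 := hz.1
        show z.1 + -δ < 0
        linarith
      exact h1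
    have hwb : ∃ K : ℝ, ∀ t < 0, ∀ x, ‖(fun r => v (r + -δ)) t x‖ ≤ K := by
      refine ⟨C / Real.sqrt δ, fun t ht x => (hdec (t + -δ) (by linarith) x).trans ?_⟩
      exact div_le_div_of_nonneg_left hC0 (Real.sqrt_pos.2 hδ) (Real.sqrt_le_sqrt (by linarith))
    have hwd : ∀ t < 0, IsWeaklyDivFree ((fun r => v (r + -δ)) t) := fun t ht =>
      hdiv (t + -δ) (by linarith)
    have hwm : ∀ s t : ℝ, s < t → t < 0 → ∀ x, (fun r => v (r + -δ)) t x =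
        UnboundedOperators.heatExtension ((fun r => v (r + -δ)) s) (t - s) x -
          oseenDuhamel 1 s (fun r => v (r + -δ)) (fun r => v (r + -δ)) t x := by
      intro s t hst ht x
      show v (t + -δ) x = UnboundedOperators.heatExtension (v (s + -δ)) (t - s) x -
        oseenDuhamel 1 s (fun r => v (r + -δ)) (fun r => v (r + -δ)) t x
      rw [oseenDuhamel_translate 1 s (-δ) v v t x,
        hmild (s + -δ) (t + -δ) (by linarith) (by linarith) x, add_sub_add_right_eq_sub]
    have hws : ∃ (σ : ℕ → ℝ) (M' : ℝ≥0∞), M' < ∞ ∧ Tendsto σ atTop atBot ∧ (∀ k, σ k < 0) ∧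
        ∀ k, eLpNorm ((fun r => v (r + -δ)) (σ k)) 3 volume ≤ M' := by
      refine ⟨fun k => τ (k + k₀) + δ, M, hM, ?_, fun k => ?_, fun k => ?_⟩
      · exact tendsto_atBot_add_const_right _ δ (hτ.comp (tendsto_add_atTop_nat k₀))
      · have h1 := hk₀ (k + k₀) (Nat.le_add_left _ _)
        linarith
      · show eLpNorm (v (τ (k + k₀) + δ + -δ)) 3 volume ≤ M
        rw [add_neg_cancel_right]
        exact hτM _
    intro t ht x
    exact AlbrittonBarker2019_liouville_L3_backward_holds hwc hwb hwd hwm hws t ht x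
  -- `δ = -t/2` at the time `t/2`
  intro t ht x
  have h := key (-t / 2) (by linarith) (t / 2) (by linarith) x
  have e : t / 2 + -(-t / 2) = t := by ring
  rwa [e] at h

/-! ## Stub S1 — Albritton–Barker 2019 Thm 1.2 in the class (backward `L³` Liouville) -/

/-- **S1 — backward `L³` Liouville in the Albritton–Barker class** (Albritton–Barker 2019, Thm 1.2,
transported to suitable weak Type-I profiles).  A suitable weak solution `(u,p)` on `ℝ³ × ℝ₋` with weak
gradient `G`, `𝐈 < ⊤` and the rate `C`, whose slices are bounded in `L³(ℝ³)` for almost every time of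
some half-line `(−∞, T₀)`, vanishes almost everywhere on the slab: pass to the continuous Oseen-mild
representative `v` (`exists_oseenMild_repr_of_typeIBound_lt_top`), pick good `L³` slices of `v` along
`τ_k → −∞` by Fubini (`lebL3B_ae_slice_ae_eq`, `lebL3B_exists_seq`), and conclude `v ≡ 0` by
`lebL3B_liouville_rate` (Thm 1.2 on the time shifts). [cite: AlbrittonBarker2019, Thm 1.2] -/
theorem stub_lebL3BackwardLiouville :
    ∀ (C : ℝ) (u : ℝ → EuclideanSpace ℝ (Fin 3) → EuclideanSpace ℝ (Fin 3))
      (p : ℝ → EuclideanSpace ℝ (Fin 3) → ℝ)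
      (G : ℝ → EuclideanSpace ℝ (Fin 3) → EuclideanSpace ℝ (Fin 3) →L[ℝ] EuclideanSpace ℝ (Fin 3)),
      IsSuitableWeakSolutionOn (slab (EuclideanSpace ℝ (Fin 3)) (Iio 0) isOpen_Iio) 1 0 u p →
      HasWeakSpatialGradientOn (slab (EuclideanSpace ℝ (Fin 3)) (Iio 0) isOpen_Iio) u G →
      typeIBound (Iio (0 : ℝ) ×ˢ univ) u p G < ⊤ →
      HasTypeITimeDecay C u →
      (∃ (M : ℝ≥0∞) (T₀ : ℝ), M < ⊤ ∧
        ∀ᵐ t ∂(volume : Measure ℝ), t < T₀ → eLpNorm (u t) 3 volume ≤ M) →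
      ∀ᵐ z ∂(volume.restrict (Iio (0 : ℝ) ×ˢ (univ : Set (EuclideanSpace ℝ (Fin 3))))),
        uncurry u z = (0 : ℝ × EuclideanSpace ℝ (Fin 3) → EuclideanSpace ℝ (Fin 3)) z := by
  intro C u p G hsw _hwg hI hdec hL3
  obtain ⟨M, T₀, hM, hbd⟩ := hL3
  -- the continuous Oseen-mild representative with the rate
  obtain ⟨v, hae, hcont, hdiv, hmild, hdecv⟩ :=
    exists_oseenMild_repr_of_typeIBound_lt_top hsw hdec hI
  -- good `L³` slices of `v`: a.e. `t < min T₀ 0`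
  have hslice : ∀ᵐ t ∂((volume : Measure ℝ).restrict (Iio 0)), u t =ᵐ[volume] v t :=
    lebL3B_ae_slice_ae_eq hae
  have hgood : ∀ᵐ t ∂(volume : Measure ℝ), t < min T₀ 0 → eLpNorm (v t) 3 volume ≤ M := by
    filter_upwards [hbd, (ae_restrict_iff' measurableSet_Iio).1 hslice] with t h1 h2
    intro ht
    rw [← eLpNorm_congr_ae (h2 (lt_of_lt_of_le ht (min_le_right _ _)))]
    exact h1 (lt_of_lt_of_le ht (min_le_left _ _))
  obtain ⟨τ, hτ, hτM⟩ := lebL3B_exists_seq hgood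
  -- A–B Thm 1.2 in the rate class: `v ≡ 0` on the open slab
  have hv0 : ∀ t < 0, ∀ x, v t x = 0 := lebL3B_liouville_rate hcont hdiv hmild hdecv hM hτ hτM
  filter_upwards [hae, ae_restrict_mem (measurableSet_Iio.prod MeasurableSet.univ)] with z hz hzmem
  rw [hz, Pi.zero_apply]
  exact hv0 z.1 hzmem.1 z.2

end Summit.NavierStokesRegularity.NavierStokesRegularity.Theorems
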